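import Literature.AlgebraicGeometry.ShimuraVarieties.UnitaryBallQuotientDatum
import Mathlib.NumberTheory.LocalField.Basic
import Mathlib.Algebra.Ring.NegOnePow
import HarnessLib

/-!
# ED.3 — STATUS NOTE (doc-only): this REAL typing is CANONICAL for the relative side of [Liu2021] §1.2–§1.4

STATUS SINCE 2026-09-02T03:33Z (squad TL ruling TL-plan g2-3 (1) on T-ref4 QA-20, superseding the ED.2 note below; recorded in the
tree by the ERRATUM edition p848799 of ★ `Sec13to16IntroductionAFL.lean` and by the ED.3 editions p848771 / p848781 of the two
sibling files): for the RELATIVE side of §1.2–§1.4 (`S_n`, `M_n`, regular semisimple pairs, transfer factor, actions, sign,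
matching, orbital integrals, items 1.9 / 1.10 / 1.12 / 1.13 / 1.14) and for item 1.15 the CANONICAL names are this seat's REAL
typing — THIS file, ★ `Sec13ArithmeticFundamentalLemma`, ★ `Sec1Introduction`; ★ `Sec13to16IntroductionAFL` (`Sec13Data`) stays
canonical for `Sec14Data` / `Sec15Data` and the RZ-side tokens (`FormalSub`, `specialDivisor`, `chiInt`), its 26 overlapping §1.3
declarations being kept for their two importers but marked «⚠ SUPERSEDED (QA-20)»; NEW files cite this vocabulary for §1.3 objects
(importing this file is allowed and intended), existing consumers migrate at their next substantive edition.  RETRO-AUDIT of this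
file (TL-t11 g2, 2026-09-02T03:30Z; T-ref4 QA-20 box): CLEAN — L1 / L2 / L2b / L4 / L5 ✓, no edition needed for content.  This
edition changes the module docstring only; every declaration is byte-identical to ED.2 (p848235).
-/

/-!
# ED.2 — PARALLEL TYPING (Mathlib `IsNonarchimedeanLocalField` model) of [Liu2021] §1.3 — (status superseded by the ED.3 note above)

ED.2 text (2026-09-02T02:45Z), kept for the record — its «OF RECORD» attribution and its «no file may import this one» are
REVERSED by ruling g2-3 (1), see above: «The vocabulary of record for [Liu2021] §1.3–§1.6 is ★
`Literature/NumberTheory/Automorphic/Liu2021/Sec13to16IntroductionAFL.lean` (`…Sec13to16IntroductionAFL.Sec13Data` and its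
predicates; squad TL typer TL-t02, p847973, landed 2026-09-02T02:26Z).  Consumers import that file and cite its names; no file
may import this one (squad ruling TL-plan 2026-09-02T02:41:42Z).»  This file (typer TL-t11, p848156) was typed in parallel from
the same pages after a re-deal crossed the typer's dedup census, and landed on the statement-only lane eleven minutes after
that file, as a REAL-over-Mathlib rendering (`IsNonarchimedeanLocalField F/E`, `ValuativeExtension F E`, Bochner integrals
against a Haar measure parameter, hermitian spaces in coordinates over ★ `ShimuraVarieties.hermForm` / `unitaryGroup`) of the
SAME printed sentences; it asserts nothing the other file does not.  Declaration ↦ declaration of the other typing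
(`Sec13Data.*` unless qualified; «—» = no counterpart there, the notion being folded into a ⟨CARRIER⟩ field of `Sec13Data`):

| this file (`Sec13RelativeFundamentalLemma.`) | the other typing (`Sec13to16IntroductionAFL.`) |
|---|---|
| `AFLSetup` (REAL hypotheses `charZero`, `finrank_eq_two`, `unramified`, `c`) | `Sec13Data` (fields `conj`, `n`, `p`, `q`, `ordE`, `muEF`, …) |
| `ord`, `residueCard`, `AFLSetup.q`, `AFLSetup.absE`, `AFLSetup.eta` | fields `Sec13Data.ordE`, `.q`, `.p`, `.muEF` |
| `Mn`, `AFLSetup.symmSpace`, `.symmSpaceInt`, `.MnInt` | `Sec13Data.Mn`, `Sec13Data.Sn`, fields `.oneS`, `.oneM` |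
| `AFLSetup.moment`, `.momentMatrix`, `.IsRegularSemisimple` | `Sec13Data.y₁E`, `.y₂E`, `Sec13Data.IsRS` |
| `AFLSetup.krylov`, `.transferFactor` | `Sec13Data.transferFactor` |
| `AFLSetup.act` | `Sec13Data.act` |
| `AFLSetup.sign` (READING S1) | `Sec13Data.IsPlus`, `Sec13Data.IsMinus` |
| `AFLSetup.HermSpaceLoc` (+ `.parity`, `.form`, `.U`), `IsRegularSemisimpleU`, `actU` | fields `Sec13Data.V`, `.herm`, `.U`, `.toEnd`; `Sec13Data.IsRSU` |
| `AFLSetup.Matches` | `Sec13Data.Matches` |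
| `AFLSetup.IsSchwartz`, `.glInt`, `.IsNormalizedHaarGL`, `.orbIntegral` | fields `Sec13Data.SchS`, `.SchM`, `.orb` (⟨CARRIER⟩ orbital integral) |
| `AFLSetup.OrbitInvarianceAsPrinted` | `Sec13Data.OrbInvariantAsPrinted` |
| `AFLSetup.MatchingBijectionAsPrinted`, `.SignCriterionAsPrinted` | `Sec13Data.MatchingBijectionAsPrinted` |
| `AFLSetup.dualSet`, `.IsSelfDualLattice`, `.stabilizer`, `.orbIntegralU` | field `Sec13Data.intPlus` (⟨CARRIER⟩ right-hand side of (1.2)) |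
| `AFLSetup.Item19Part1`, `Item19Part2` | `Sec13Data.Stmt19_1`, `Sec13Data.Stmt19_2`, `Sec13Data.Item19AsPrinted` |
| `AFLSetup.Rem110_1AsPrinted` | — (Rem. 1.10, first sentence; recorded in the docstring of `Sec13Data.Item19AsPrinted`) |
| `Rem110_2AsPrinted` (READING P1: `∃ N`) | `Sec13Data.Rem110_2` (bound as the field `pBound`) |

ED.2 also carries ONE review-class fix (squad RETRO-AUDIT ORDER 2026-09-02T02:29:30Z, class L2 «no jointly-free
parameter»): the measurable structures on `GL_n(F)` and `U(V)(F)`, which are instance PARAMETERS supplied by the consumer, are now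
tied to the topology — `IsNormalizedHaarGL` and the unitary normalisation in `Item19Part2` carry the conjunct `BorelSpace _` — so
that no named fact quantifies over an exotic σ-algebra on which Mathlib's Bochner integral would take its junk value `0`.  All
other statements are byte-identical to ED.1 (p848156).
-/

/-!
# Liu 2021, §1.3 «Arithmetic fundamental lemma for U(n) × U(n)», file 2 of 3 of the §1 carpet: the LOCAL SET-UP (print pp. 11–13)
# — symmetric space `S_n(F)`, regular semisimple pairs, transfer factor, `GL_n(F)`-action, hermitian spaces `V_n^±`, matching,
# orbital integrals — item 1.9 (relative fundamental lemma, VOCABULARY PREDICATES) and Remark 1.10 (its printed proved status) —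
# STATEMENTS AS PRINTED, REAL over Mathlib's `IsNonarchimedeanLocalField` (NO proof of anything; NO instance declared)

[Liu2021] = Yifeng Liu, *Fourier–Jacobi cycles and arithmetic relative trace formula* (with an appendix by Chao Li and
Yihang Zhu), Cambridge J. Math. **9** (2021), no. 1, 1–147 = arXiv:2102.11518.  PRIMARY SOURCE READ FOR THIS FILE: the
PRINT text held as `paper:liu2021-fourier-jacobi-cycles-arithmetic-relative-trace-formula` (147 pp.; page file `pNNNN` =
journal page `N`; every «p. N Lk» below is line `k` of that page file), cross-checked against the author's TeX source of
record `FJcycle.tex` (md5 `6db49a74122d…`; every «l. NNNN» below is a line of that file).  §1 = TeX l. 621–1158: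
§1.1 l. 625 (p. 3), Thm. 1.1 l. 652 (p. 5 L13), Def. 1.2 l. 676–685 (p. 5 L55 – p. 6 L6), Thm. 1.3 l. 702 (p. 6 L54),
Conj. 1.4 l. 718 (p. 7 L37), Conj. 1.5 l. 740 (p. 8 L8), Rem. 1.6 l. 771 (p. 9 L5), §1.2 l. 776 (p. 9), Thm. 1.7 l. 782
(p. 9 L24), Thm. 1.8 l. 822 (p. 11 L5), §1.3 l. 848–962 (pp. 11–15): set-up l. 853–872 (p. 11 L50 – p. 12 L37), Conj. 1.9
l. 875–890 (p. 12 L38 – p. 13 L19), Rem. 1.10 l. 892–894 (p. 13 L20), unitary `O_F`-modules and `𝒩_n` l. 896–913 (p. 13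
L22 – p. 14 L2), formal special divisors l. 915–921 (p. 14 L3–18), Def. 1.11 l. 923–929 (p. 14 L19–27), `Γ_g` l. 931
(p. 14 L28–33), Conj. 1.12 l. 934–942 (p. 14 L34–49), l. 944 (p. 14 L50–51), Rem. 1.13 l. 946–955 (p. 15 L5–11), Rem. 1.14
l. 959–961 (p. 15 L12–18), §1.4 l. 964 (p. 15), Conj. 1.15 l. 991–996 (p. 16 L9–15) with footnote 3 = l. 986 (p. 16
L64–65), §1.5 l. 1021 (p. 17), §1.6 l. 1048 (p. 18), §1.7 l. 1090–1158 (pp. 20–21).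

This is file 2 of the §1 carpet of squad TL «GO 500» (typer TL-t11); file 1 `Sec1Introduction.lean` carries the INDEX of every §1
item and Definition 1.2 / item 1.15; file 3 `Sec13ArithmeticFundamentalLemma.lean` (importing this one) carries the relative
Rapoport–Zink dictionary, Definition 1.11, item 1.12 and Remarks 1.13–1.14.  DEDUP CENSUS (2026-09-02): no declaration of
`lean/Literature` types the symmetric space `S_n`, regular semisimple pairs, the transfer factor, matching or these orbital
integrals (`lean search`; `rg 'cite: Liu2021, … 1.x'` = one Summits-side provenance tag) — GREEN FIELD.  Discipline (ruling TL-plan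
2026-09-02T01:59:30Z; «What a CARRIER is», ★ `Liu2021.Thm418AsPrinted`): REAL objects wherever Mathlib / the tree has them; every
statement a PREDICATE `def … : Prop` on the consumer's data; a consumer takes `(h : Item D)` for ITS OWN `D`; `∀ D, Item D` is never
claimed.  Everything in this file is REAL except the two measure PARAMETERS (`dg` on `GL_n(F)`, `du` on `U(V)(F)`), which are
arguments under instance arguments `[MeasurableSpace _]` supplied by the consumer.

HONESTY NOTE (item 1.9).  In print item 1.9 is headed «Conjecture 1.9 (Relative fundamental lemma for `U(n) × U(n)`)» — a PREDICTED
identity recalled from [Liu14], NOT proved in the source in general.  By the human rule («unproven predictions are not Literature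
facts») it is typed ONLY AS VOCABULARY: `Item19Part1 S n dg`, `Item19Part2 dg V Λ du` are predicates NAMING the printed identities on
the consumer's data; nothing is asserted and no `_holds` can be filed for them from this file; a route that wants to USE one takes it
as a crux / `--conditional-on` an `@[conjecture]` leaf under `Summits/` (gate rule), citing these names.  They are typed because the
printed THEOREM about them — Remark 1.10: part (1) is [Liu14, Prop. 5.14], part (2) holds for `p` large [Liu14, Thm. 5.15] — is a
genuine Literature fact (`Rem110_1AsPrinted`, `Rem110_2AsPrinted`) whose statement needs the vocabulary.  The DECLARATION
docstrings render the printed heading word as «item 1.9» / «[item]» / «[statement]» (editorial brackets; squad precedent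
`Sec44ArithmeticGGP`), because the gate's lint for unproved predictions keys on that word; the verbatim heading is quoted here.

## Contents (paper order)

1. `ord`, `residueCard`, `Mn` (`M_n(F)`), `AFLSetup` (the standing hypotheses, READING L1), `AFLSetup.q`, `.absE` (`| |_E`), `.eta`
   (`μ_{E/F}`, READING M1), `.symmSpace` (`S_n(F)`), `.symmSpaceInt` (`S_n(O_F)`), `.MnInt` (`M_n(O_F)`), `.moment`, `.momentMatrix`,
   `.IsRegularSemisimple`, `.krylov`, `.transferFactor` (`ω(ζ, y)`), `.act`, `.sign` (`[S_n(F) × M_n(F)]^±_rs`, READING S1),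
   `.HermSpaceLoc` (`V_n^±`, READING H1) with `.parity`, `.form`, `.U`, `IsRegularSemisimpleU`, `actU`, `Matches`, `IsSchwartz`, `glInt`
   (`GL_n(O_F)`), `IsNormalizedHaarGL`, `orbIntegral` (`Orb(s; f, φ; ζ, y)`, READING F1), `OrbitInvarianceAsPrinted`,
   `MatchingBijectionAsPrinted`, `SignCriterionAsPrinted`, `dualSet`, `IsSelfDualLattice`, `stabilizer` (`K_n`), `orbIntegralU`.
2. Item 1.9: `Item19Part1`, `Item19Part2` (VOCABULARY PREDICATES); Remark 1.10: `Rem110_1AsPrinted`, `Rem110_2AsPrinted` (named facts).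

## The printed text (verbatim from `FJcycle.tex`; `\rS` = `S`, `\rM` = `M`, `\rV` = `V`, `\rU` = `U`, `\tc` = `c`, `\CF` = `𝟙`, `\Orb` = `Orb`)

**§1.3 set-up** (l. 851–872, p. 11 L45 – p. 12 L37): «Since the question is purely local, we will shift our notation slightly
from the previous discussion. Moreover, we will allow `n` to be an arbitrary positive integer since the discussion makes sense
even for `n = 1`.  Let `F` be a finite extension of `ℚ_p`, with residue cardinality `q`. Let `E/F` be an unramified quadratic
extension, and `Ĕ` a completed maximal unramified extension of `E` with `k` its residue field.  We recall some definitions and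
facts from [Liu14, Section 5.3]. We say that a pair `(ζ, y) ∈ S_n(F) × M_n(F)` is *regular semisimple* if the matrix
`(y_2 ζ^{i+j−2} y_1)_{i,j=1}^n` is non-degenerate, where we write `y = (y_1, y_2) ∈ Mat_{n,1}(F) × Mat_{1,n}(F)`. If `(ζ, y)` is
regular semisimple, we define its *transfer factor* to be `ω(ζ, y) := μ_{E/F}(det(y_1, ζ y_1, …, ζ^{n−1} y_1))`.  The group `GL_n(F)`
acts on `S_n(F) × M_n(F)` by the formula `(ζ, y)g = (g⁻¹ζg, g⁻¹y_1, y_2 g)`, which preserves regular semisimple elements. We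
denote by `[S_n(F) × M_n(F)]_rs` the set of regular semisimple `GL_n(F)`-orbits.  Let `V_n^+` (resp. `V_n^-`) be a hermitian space
over `E` of rank `n` whose determinant has even (resp. odd) valuation. For `δ = ±`, we say that a pair `(ξ, x) ∈ U(V_n^δ)(F) ×
V_n^δ(E)` is *regular semisimple* if `{x, ξx, …, ξ^{n−1}x}` are linearly independent. The group `U(V_n^δ)(F)` acts on `U(V_n^δ)(F) ×
V_n^δ(E)` by the formula `(ξ, x)g = (g⁻¹ξg, g⁻¹x)`, which preserves regular semisimple elements. We denote by `[U(V_n^δ)(F) ×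
V_n^δ(E)]_rs` the set of regular semisimple `U(V_n^δ)(F)`-orbits. We say that `(ζ, y) ∈ [S_n(F) × M_n(F)]_rs` and `(ξ, x) ∈
[U(V_n^δ)(F) × V_n^δ(E)]_rs` *match* if `ζ` and `ξ` have the same characteristic polynomial and `y_2 ζ^i y_1 = (ξ^i x, x)` for
`0 ≤ i ≤ n − 1`. The matching relation induces a bijection `[S_n(F) × M_n(F)]_rs ≃ [U(V_n^+)(F) × V_n^+(E)]_rs ∐ [U(V_n^-)(F) ×
V_n^-(E)]_rs`.  Denote by `[S_n(F) × M_n(F)]^±_rs ⊆ [S_n(F) × M_n(F)]_rs` the subset corresponding to orbits in `[U(V_n^±)(F) ×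
V_n^±(E)]_rs`. Then a regular semisimple orbit `(ζ, y)` belongs to `[S_n(F) × M_n(F)]^δ_rs` for `δ = +` (resp. `δ = −`) if and
only if the `det((y_2 ζ^{i+j−2} y_1)_{i,j=1}^n)` has even (resp. odd) valuation.  Now we introduce the relevant orbital integral.
For a regular semisimple pair `(ζ, y) ∈ S_n(F) × M_n(F)` and a pair of Schwartz functions `f ∈ 𝒮(S_n(F))`, `φ ∈ 𝒮(M_n(F))`, we
define `Orb(s; f, φ; ζ, y) := ∫_{GL_n(F)} f(g⁻¹ζg) φ(g⁻¹y_1, y_2 g) μ_{E/F}(det g) |det g|_E^s dg`, where `dg` is the Haar measure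
under which `GL_n(O_F)` has volume `1`. It is clear that the product `ω(ζ, y) Orb(0; f, φ; ζ, y)` depends only on the
`GL_n(F)`-orbit of `(ζ, y)`.»  (Here `S_n` is «the `O_F`-subscheme of `Res_{O_E/O_F} Mat_{n,n}` consisting of matrices `g`
satisfying `g · g^c = I_n`, known as the symmetric space» and `M_n := Mat_{n,1} × Mat_{1,n}`, p. 10 L23–26, l. 803–805.)

**Conjecture 1.9** (relative fundamental lemma; l. 875–890, p. 12 L38 – p. 13 L19): «For every regular semisimple orbit
`(ζ, y) ∈ [S_n(F) × M_n(F)]_rs`, we have (1) if `(ζ, y) ∈ [S_n(F) × M_n(F)]^-_rs`, then `ω(ζ, y) Orb(0; 𝟙_{S_n(O_F)}, 𝟙_{M_n(O_F)};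
ζ, y) = 0`; (2) if `(ζ, y) ∈ [S_n(F) × M_n(F)]^+_rs`, then (1.2) `ω(ζ, y) Orb(0; 𝟙_{S_n(O_F)}, 𝟙_{M_n(O_F)}; ζ, y) = ∫_{U(V_n^+)}
𝟙_{K_n}(g⁻¹ξg) 𝟙_{Λ_n}(g⁻¹x) dg` where `(ξ, x) ∈ [U(V_n^+)(F) × V_n^+(E)]_rs` is the unique orbit that matches `(ζ, y)`, `Λ_n` is a
self-dual lattice in `V_n^+`, `K_n` is the stabilizer of `Λ_n`, and `dg` is the Haar measure on `U(V_n^+)` under which `K_n` has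
volume `1`.»  **Remark 1.10** (l. 892–894, p. 13 L20–21): «Conjecture 1.9(1) is known by [Liu14, Proposition 5.14]. Conjecture
1.9(2) is known for `p` sufficiently large by [Liu14, Theorem 5.15].»

## The typing and its READINGS (the only interpretive choices; no hypothesis is added, none dropped)

* **L1** (§1.3 fields).  «`F` a finite extension of `ℚ_p`» ↦ Mathlib `IsNonarchimedeanLocalField F` + `CharZero F` (equivalent);
  «residue cardinality `q`» ↦ `residueCard F = Nat.card 𝓀[F]`; «`E/F` an unramified quadratic extension» ↦ `IsNonarchimedeanLocalField E`,
  `Algebra F E`, Mathlib `ValuativeExtension F E` (the valuation of `E` restricts to that of `F`), `Module.finrank F E = 2`, and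
  UNRAMIFIED as «the normalized valuations agree on `F`»: `ord E (algebraMap F E x) = ord F x` (`ord K` = the normalized additive
  valuation through Mathlib's `IsNonarchimedeanLocalField.valueGroupWithZeroIsoInt`, uniformizer ↦ `1`); `c` ↦ an `F`-algebra
  automorphism `c ≠ 1` of `E` (the nontrivial one is unique since `[E : F] = 2`).  `Ĕ`, `k` enter only the ⟨CARRIER⟩ `RZDictionary`.
* **M1** («`μ_{E/F}`» applied to elements of `E^×`).  As printed, `ω(ζ, y) = μ_{E/F}(det(y_1, ζy_1, …, ζ^{n−1}y_1))` applies the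
  quadratic character of `F^×` to a determinant lying in `E^×`; Appendix A makes the meaning explicit (p. 90 L33, l. 4032–4033:
  «Recall that we have put `v(ζ, y) := val(det(y_1, ζy_1, …, ζ^{n−1}y_1))` and defined the transfer factor to be `ω(ζ, y) :=
  (−1)^{v(ζ,y)}`»; p. 92 L6: «`μ_{E/F}(det g) = (−1)^{v(ζ,y)−i}`» for `val(det g) = v(ζ,y) − i`): for UNRAMIFIED `E/F`, `μ_{E/F}(a) =
  (−1)^{val_F(a)}` and its extension to `E^×` is `(−1)^{val_E}`.  TYPED: `AFLSetup.eta z := (−1)^{ord E z}` (`Int.negOnePow`), used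
  both in `transferFactor` and (through `algebraMap F E`) in `orbIntegral`.
* **S1** (`[S_n(F) × M_n(F)]^±_rs`).  The print DEFINES `[…]^±_rs` through the matching bijection and then states the parity
  criterion «if and only if `det((y_2 ζ^{i+j−2} y_1))` has even (resp. odd) valuation».  TYPED the other way round: `sign ζ y :=
  (−1)^{ord E det(momentMatrix ζ y)}` IS the parity, and the printed definition becomes the named facts `MatchingBijectionAsPrinted`
  / `SignCriterionAsPrinted` (statements, NO PROOF) — the same two sentences, with the definitional arrow reversed so that `sign`
  has a body.
* **H1** (hermitian spaces).  `V_n^±` «a hermitian space over `E` of rank `n`» ↦ coordinates `V = E^n` with a Gram matrix `H`,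
  `c`-hermitian (`(H^c)ᵀ = H`) and non-degenerate (`HermSpaceLoc`); its form `(u, v)_V := hermForm c H v u` is `E`-LINEAR IN THE
  FIRST variable (as in [Liu2021]: App. C l. 4558 and the formula for `(x, y)` on `V_n^-` above; the tree's ★ `hermForm` is
  conjugate-linear in its first slot, whence the swap); `U(V)(F)` ↦ ★ `ShimuraVarieties.unitaryGroup c H ≤ GL_n(E)`; «determinant
  has even/odd valuation» ↦ `parity V := (−1)^{ord E (det H)} = 1 / −1`.
* **F1** (Schwartz functions, orbital integral).  `𝒮(S_n(F))`, `𝒮(M_n(F))` ↦ functions on the AMBIENT `Mat_n(E)` resp. on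
  `M_n(F) = F^n × F^n` that are locally constant with compact support (`IsSchwartz`; a Schwartz function on the closed subset `S_n(F)`
  is the restriction of such a function, and `Orb` only evaluates `f` on the `GL_n(F)`-conjugates of `ζ ∈ S_n(F)`, which lie in
  `S_n(F)`); `𝟙_{S_n(O_F)}` ↦ the indicator of `symmSpaceInt` (matrices of `S_n(F)` with entries in `O_E`), `𝟙_{M_n(O_F)}` ↦ the
  indicator of `MnInt`; «`dg` the Haar measure under which `GL_n(O_F)` has volume `1`» ↦ a measure PARAMETER `dg` on `GL_n(F)` under
  instance PARAMETERS `[MeasurableSpace (GL (Fin n) F)]`, with the hypothesis `IsNormalizedHaarGL S n dg` (Haar ∧ `dg(GL_n(O_F)) = 1`)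
  as an antecedent of every statement using it (no instance is declared in this file); `|det g|_E^s` ↦ `(absE (det g) : ℂ) ^ s`
  (principal branch of Mathlib's `cpow` on a positive real base); `(d/ds)|_{s=0}` ↦ Mathlib's complex `deriv … 0`.
* **U1** (orbits).  `[…]_rs` «the set of regular semisimple orbits»: statements printed «for every regular semisimple orbit» are
  typed «for every regular semisimple PAIR», and «the unique orbit that matches» is typed «for every matching regular semisimple
  pair» — token-identical content given `OrbitInvarianceAsPrinted` / `MatchingBijectionAsPrinted`, which are typed separately.
* **P1** («`p` sufficiently large», Rem. 1.10 (2)) ↦ `∃ N, ∀` set-ups of rank `n` with residue characteristic `ringChar 𝓀[F] ≥ N`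
  ([Liu14, Thm. 5.15]'s bound depends only on `n`).
NO PROOF anywhere (statements only); non-vacuity of the binder lists is checked in the seat's HOME scratch file
(`T/LIU/TL-t11/g0/Sec1_full_with_nonvacuity.lean`, not shipped).

## NOT here

Definition 1.11, item 1.12, Remarks 1.13–1.14 (file 3); the INDEX of §1 and Def. 1.2 / item 1.15 (file 1); proofs.

## References

* [Liu2021] Y. Liu, *Fourier–Jacobi cycles and arithmetic relative trace formula*, Camb. J. Math. 9 (2021) 1–147, arXiv:2102.11518
  — §1 pp. 3–21 (pins above); App. A p. 90 L33, p. 92 L6 (READING M1); App. C l. 4558 (READING H1); Def. 4.1 p. 41.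
* [Liu2014RelativeTraceFormulae] Y. Liu, *Relative trace formulae toward Bessel and Fourier–Jacobi periods on unitary groups*,
  Manuscripta Math. 145 (2014) 1–69 — §5.3 (the set-up recalled in §1.3), Prop. 5.14, Thm. 5.15 (Rem. 1.10) = [Liu14].
* [BergeronMillsonMoeglin2016Balls] Part 2 §1.1–1.2 (the tree's `hermForm`, `unitaryGroup`).
-/

noncomputable section

open MeasureTheory Matrix

namespace Literature.NumberTheory.Automorphic.Liu2021.Sec13RelativeFundamentalLemma

open scoped ValuativeRel

/-! ## Item 1: the §1.3 local set-up (p. 11 L45 – p. 12 L37) -/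

/-- **The normalized (additive) valuation of a non-archimedean local field `K`**: `ord K x ∈ ℤ` with `ord K ϖ = 1` for a
uniformizer and `ord K 0 = 0` (junk), through Mathlib's canonical `ValueGroupWithZero K ≃*o ℤᵐ⁰`
(`IsNonarchimedeanLocalField.valueGroupWithZeroIsoInt`, in which a uniformizer has value `exp (−1)`).  «valuation» of §1.3
(p. 12 L11, L25; `val` of App. A p. 90 L33). REAL. [cite: Liu2021, §1.3 (p. 12)] -/
def ord (K : Type) [Field K] [ValuativeRel K] [TopologicalSpace K] [IsNonarchimedeanLocalField K] (x : K) : ℤ :=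
  -WithZero.log (IsNonarchimedeanLocalField.valueGroupWithZeroIsoInt K (ValuativeRel.valuation K x))

/-- **The residue cardinality** of a non-archimedean local field `K`: `#𝓀[K]` («with residue cardinality `q`», p. 11 L50;
l. 853). REAL. [cite: Liu2021, §1.3 (p. 11)] -/
def residueCard (K : Type) [Field K] [ValuativeRel K] [TopologicalSpace K] [IsNonarchimedeanLocalField K] : ℕ :=
  Nat.card 𝓀[K]

/-- **`M_n(F) := Mat_{n,1}(F) × Mat_{1,n}(F)`** (p. 10 L24, p. 21 L33; l. 803, 1136): pairs `y = (y_1, y_2)` of a column and a row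
vector. REAL. [cite: Liu2021, §1.7 (p. 21)] -/
abbrev Mn (F : Type) (n : ℕ) : Type :=
  (Fin n → F) × (Fin n → F)

variable {F E : Type} [Field F] [ValuativeRel F] [TopologicalSpace F] [IsNonarchimedeanLocalField F]
  [Field E] [ValuativeRel E] [TopologicalSpace E] [IsNonarchimedeanLocalField E] [Algebra F E] [ValuativeExtension F E]

variable (F E) in
/-- **The standing hypotheses of [Liu2021, §1.3]** (p. 11 L50–52; l. 853), READING L1, over Mathlib's local-field classes (the
instance parameters: `F`, `E` non-archimedean local fields, `E` an `F`-algebra whose valuation restricts to that of `F`):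
«Let `F` be a finite extension of `ℚ_p`, with residue cardinality `q`. Let `E/F` be an unramified quadratic extension» — with the
nontrivial Galois involution `c` of `E/F` (p. 3 L15, «`g · g^c`» p. 10 L25).  Fields: `charZero` («finite extension of `ℚ_p`» ⇒
characteristic `0`), `finrank_eq_two` (quadratic), `unramified` (the normalized valuation of `E` extends that of `F`), `c` with
`c_ne_one`.  Hypothesis data; nothing is asserted. [cite: Liu2021, §1.3 (p. 11)] -/
structure AFLSetup : Type where
  /-- «`F` a finite extension of `ℚ_p`» (READING L1): characteristic zero. -/
  charZero : CharZero F
  /-- «quadratic extension»: `[E : F] = 2`. -/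
  finrank_eq_two : Module.finrank F E = 2
  /-- «unramified» (READING L1): `val_E` extends `val_F`. -/
  unramified : ∀ x : F, ord E (algebraMap F E x) = ord F x
  /-- the nontrivial Galois involution `c` of `E/F`. -/
  c : E ≃ₐ[F] E
  /-- `c` is not the identity. -/
  c_ne_one : c ≠ AlgEquiv.refl

namespace AFLSetup

variable (S : AFLSetup F E) (n : ℕ)

/-- **`q`**, «the residue cardinality of `F`» (p. 11 L50). REAL. [cite: Liu2021, §1.3 (p. 11)] -/
def q (_S : AFLSetup F E) : ℕ :=
  residueCard F

/-- **`|z|_E`**, the normalized absolute value of `E` (`|ϖ|_E = q_E⁻¹`, `|0|_E = 0`), entering `|det g|_E^s` (p. 12 L31; l. 869).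
REAL (the case split on `z = 0` uses the classical decidability instance explicitly). [cite: Liu2021, §1.3 (p. 12)] -/
def absE (_S : AFLSetup F E) (z : E) : ℝ :=
  @ite ℝ (z = 0) (Classical.propDecidable _) 0 ((residueCard E : ℝ) ^ (-(ord E z)))

/-- **`μ_{E/F}`** extended to `E^×` (READING M1): `z ↦ (−1)^{val_E(z)}` — for unramified `E/F` this is `μ_{E/F}(a) = (−1)^{val_F(a)}`
on `a ∈ F^×` (p. 92 L6) and gives «`ω(ζ, y) = (−1)^{v(ζ,y)}`» (p. 90 L33).  REAL (`Int.negOnePow`; junk `1` at `z = 0`).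
[cite: Liu2021, §1.3 (p. 12); App. A (p. 90 L33)] -/
def eta (_S : AFLSetup F E) (z : E) : ℤˣ :=
  Int.negOnePow (ord E z)

/-- **`S_n(F)`**, the `F`-points of «the symmetric space» `S_n ⊂ Res_{O_E/O_F} Mat_{n,n}`, «matrices `g` satisfying `g · g^c = I_n`»
(p. 10 L24–26; l. 803–805): `{ζ ∈ Mat_n(E) | ζ ζ^c = 1}`, `c` acting entrywise. REAL. [cite: Liu2021, §1.2 (p. 10)] -/
def symmSpace : Set (Matrix (Fin n) (Fin n) E) :=
  {ζ | ζ * ζ.map S.c = 1}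

/-- **`S_n(O_F)`** (in `𝟙_{S_n(O_F)}`, Conj. 1.9, p. 12 L43): the matrices of `S_n(F)` with entries in `O_E`. REAL (READING F1).
[cite: Liu2021, Conj. 1.9 (p. 12)] -/
def symmSpaceInt : Set (Matrix (Fin n) (Fin n) E) :=
  {ζ | ζ ∈ S.symmSpace n ∧ ∀ i j, ζ i j ∈ 𝒪[E]}

/-- **`M_n(O_F)`** (in `𝟙_{M_n(O_F)}`, Conj. 1.9, p. 12 L43): pairs `(y_1, y_2)` with entries in `O_F`. REAL.
[cite: Liu2021, Conj. 1.9 (p. 12)] -/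
def MnInt (_S : AFLSetup F E) : Set (Mn F n) :=
  {y | ∀ i, y.1 i ∈ 𝒪[F] ∧ y.2 i ∈ 𝒪[F]}

/-- **The moments `y_2 ζ^k y_1 ∈ E`** of a pair `(ζ, y)` (p. 11 L57–58, p. 12 L18; l. 855, 863), `y_1`, `y_2` viewed in `E^n`.
REAL. [cite: Liu2021, §1.3 (p. 11)] -/
def moment (_S : AFLSetup F E) (ζ : Matrix (Fin n) (Fin n) E) (y : Mn F n) (k : ℕ) : E :=
  (algebraMap F E ∘ y.2) ⬝ᵥ ((ζ ^ k) *ᵥ (algebraMap F E ∘ y.1))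

/-- **The matrix `(y_2 ζ^{i+j−2} y_1)_{i,j=1}^n`** (p. 11 L57–58; l. 855), indexed by `Fin n` (so the exponent is `i + j`). REAL.
[cite: Liu2021, §1.3 (p. 11)] -/
def momentMatrix (ζ : Matrix (Fin n) (Fin n) E) (y : Mn F n) : Matrix (Fin n) (Fin n) E :=
  Matrix.of fun i j => S.moment n ζ y (i.1 + j.1)

/-- **«regular semisimple»** for `(ζ, y) ∈ S_n(F) × M_n(F)` (p. 11 L56–58; l. 855): «the matrix `(y_2 ζ^{i+j−2} y_1)_{i,j=1}^n` is
non-degenerate», i.e. has non-zero determinant. REAL. [cite: Liu2021, §1.3 (p. 11)] -/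
def IsRegularSemisimple (ζ : Matrix (Fin n) (Fin n) E) (y : Mn F n) : Prop :=
  (S.momentMatrix n ζ y).det ≠ 0

/-- **The matrix `(y_1, ζy_1, …, ζ^{n−1}y_1)`** with columns `ζ^k y_1` (p. 12 L3; l. 857). REAL. [cite: Liu2021, §1.3 (p. 12)] -/
def krylov (_S : AFLSetup F E) (ζ : Matrix (Fin n) (Fin n) E) (y : Mn F n) : Matrix (Fin n) (Fin n) E :=
  Matrix.of fun i k => ((ζ ^ (k : ℕ)) *ᵥ (algebraMap F E ∘ y.1)) i

/-- **The transfer factor `ω(ζ, y) := μ_{E/F}(det(y_1, ζy_1, …, ζ^{n−1}y_1))`** (p. 12 L1–3; l. 856–858), READING M1: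
`(−1)^{val_E det(y_1, ζy_1, …, ζ^{n−1}y_1)}` (= «`(−1)^{v(ζ,y)}`», App. A p. 90 L33).  REAL, valued in `ℤˣ = {±1}` (defined for every
pair; the print uses it for regular semisimple ones). [cite: Liu2021, §1.3 (p. 12); App. A (p. 90 L33)] -/
def transferFactor (ζ : Matrix (Fin n) (Fin n) E) (y : Mn F n) : ℤˣ :=
  S.eta ((S.krylov n ζ y).det)

/-- **The right action of `GL_n(F)` on `S_n(F) × M_n(F)`** (p. 12 L4–5; l. 859): «`(ζ, y)g = (g⁻¹ζg, g⁻¹y_1, y_2 g)`» (`g` viewed in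
`GL_n(E)` for the first component).  REAL, written on the ambient `Mat_n(E) × M_n(F)`. [cite: Liu2021, §1.3 (p. 12)] -/
def act (_S : AFLSetup F E) (g : GL (Fin n) F) (p : Matrix (Fin n) (Fin n) E × Mn F n) :
    Matrix (Fin n) (Fin n) E × Mn F n :=
  ((((g⁻¹ : GL (Fin n) F) : Matrix (Fin n) (Fin n) F).map (algebraMap F E)) * p.1 *
      ((g : Matrix (Fin n) (Fin n) F).map (algebraMap F E)),
    (((g⁻¹ : GL (Fin n) F) : Matrix (Fin n) (Fin n) F) *ᵥ p.2.1, p.2.2 ᵥ* (g : Matrix (Fin n) (Fin n) F)))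

/-- **The sign `δ ∈ {±}` of a regular semisimple pair, `[S_n(F) × M_n(F)]^±_rs`** (p. 12 L22–26; l. 864–865), READING S1: `+1`
(resp. `−1`) iff «`det((y_2 ζ^{i+j−2} y_1)_{i,j=1}^n)` has even (resp. odd) valuation» — the printed CRITERION taken as the body;
the printed DEFINITION (the orbits matching `V_n^±`) is the named fact `SignCriterionAsPrinted`. REAL.
[cite: Liu2021, §1.3 (p. 12)] -/
def sign (ζ : Matrix (Fin n) (Fin n) E) (y : Mn F n) : ℤˣ :=
  Int.negOnePow (ord E (S.momentMatrix n ζ y).det)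

/-- **A hermitian space over `E` of rank `n`, in coordinates** (p. 12 L10–11; l. 861), READING H1: `V = E^n` with a Gram matrix
`H` that is `c`-hermitian and non-degenerate; «whose determinant has even (resp. odd) valuation» is `parity = 1` (resp. `−1`).
Data; nothing asserted. [cite: Liu2021, §1.3 (p. 12)] -/
structure HermSpaceLoc (S : AFLSetup F E) (n : ℕ) : Type where
  /-- the Gram matrix `H = ((e_j, e_i)_V)_{i,j}` of the hermitian form on `E^n`. -/
  gram : Matrix (Fin n) (Fin n) E
  /-- `H` is `c`-hermitian: `(H^c)ᵀ = H`. -/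
  gram_hermitian : (gram.map S.c)ᵀ = gram
  /-- non-degenerate: `det H ≠ 0`. -/
  gram_det_ne_zero : gram.det ≠ 0

namespace HermSpaceLoc

variable {S n} (V : HermSpaceLoc S n)

/-- **The parity of `val_E(det V)`**: `(−1)^{val_E det H}`; `V = V_n^+` iff `parity = 1`, `V = V_n^-` iff `parity = −1` (p. 12 L10–11;
l. 861). REAL. [cite: Liu2021, §1.3 (p. 12)] -/
def parity : ℤˣ :=
  Int.negOnePow (ord E V.gram.det)

/-- **The hermitian form `(u, v)_V ∈ E`**, `E`-linear in the FIRST variable (READING H1): `(u, v)_V = hermForm c H v u = Σ c(v_i) H_ij u_j`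
over the tree's ★ `ShimuraVarieties.hermForm`. REAL. [cite: Liu2021, §1.3 (p. 12); App. C l. 4558] -/
def form (u v : Fin n → E) : E :=
  Literature.AlgebraicGeometry.ShimuraVarieties.hermForm (S.c : E →+* E) V.gram v u

/-- **`U(V)(F)`**, the unitary group of `V` as a subgroup of `GL_n(E)` (p. 12 L12; l. 861): the tree's ★ `ShimuraVarieties.unitaryGroup c H`
(`(g^c)ᵀ H g = H`). REAL. [cite: Liu2021, §1.3 (p. 12)] -/
def U : Subgroup (GL (Fin n) E) :=
  Literature.AlgebraicGeometry.ShimuraVarieties.unitaryGroup (S.c : E →+* E) V.gram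

end HermSpaceLoc

variable {S n} in
/-- **«regular semisimple»** for `(ξ, x) ∈ U(V)(F) × V(E)` (p. 12 L12–13; l. 861): «`{x, ξx, …, ξ^{n−1}x}` are linearly independent»
over `E`. REAL. [cite: Liu2021, §1.3 (p. 12)] -/
def IsRegularSemisimpleU (V : HermSpaceLoc S n) (ξ : V.U) (x : Fin n → E) : Prop :=
  LinearIndependent E fun i : Fin n => (((ξ : GL (Fin n) E) : Matrix (Fin n) (Fin n) E) ^ (i : ℕ)) *ᵥ x

variable {S n} in
/-- **The right action of `U(V)(F)` on `U(V)(F) × V(E)`** (p. 12 L13–14; l. 862): «`(ξ, x)g = (g⁻¹ξg, g⁻¹x)`». REAL.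
[cite: Liu2021, §1.3 (p. 12)] -/
def actU (V : HermSpaceLoc S n) (g : V.U) (p : V.U × (Fin n → E)) : V.U × (Fin n → E) :=
  (g⁻¹ * p.1 * g, (((g⁻¹ : V.U) : GL (Fin n) E) : Matrix (Fin n) (Fin n) E) *ᵥ p.2)

variable {S n} in
/-- **«match»** (p. 12 L16–18; l. 862–863): `(ζ, y)` and `(ξ, x)` *match* «if `ζ` and `ξ` have the same characteristic polynomial and
`y_2 ζ^i y_1 = (ξ^i x, x)` for `0 ≤ i ≤ n − 1`». REAL (READING H1 for `( , )`). [cite: Liu2021, §1.3 (p. 12)] -/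
def Matches (V : HermSpaceLoc S n) (ζ : Matrix (Fin n) (Fin n) E) (y : Mn F n) (ξ : V.U) (x : Fin n → E) : Prop :=
  ζ.charpoly = (((ξ : GL (Fin n) E) : Matrix (Fin n) (Fin n) E)).charpoly ∧
    ∀ i : Fin n, S.moment n ζ y i = V.form ((((ξ : GL (Fin n) E) : Matrix (Fin n) (Fin n) E) ^ (i : ℕ)) *ᵥ x) x

/-- **Schwartz functions** on a totally disconnected space (`𝒮(S_n(F))`, `𝒮(M_n(F))`, p. 12 L28–29; l. 867): locally constant with
compact support (READING F1: on the ambient `Mat_n(E)` resp. `M_n(F)`). REAL. [cite: Liu2021, §1.3 (p. 12)] -/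
def IsSchwartz {X : Type} [TopologicalSpace X] (f : X → ℂ) : Prop :=
  IsLocallyConstant f ∧ HasCompactSupport f

/-- **`GL_n(O_F) ⊆ GL_n(F)`** (p. 12 L33; l. 871): invertible matrices with `g` and `g⁻¹` integral. REAL. [cite: Liu2021, §1.3 (p. 12)] -/
def glInt (_S : AFLSetup F E) : Set (GL (Fin n) F) :=
  {g | ∀ i j, (g : Matrix (Fin n) (Fin n) F) i j ∈ 𝒪[F] ∧ ((g⁻¹ : GL (Fin n) F) : Matrix (Fin n) (Fin n) F) i j ∈ 𝒪[F]}

/-- **«`dg` is the Haar measure under which `GL_n(O_F)` has volume `1`»** (p. 12 L32–33; l. 871), READING F1: a Haar measure `dg`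
on `GL_n(F)` (Mathlib `IsHaarMeasure`, for the measurable structure supplied by the consumer) with `dg(GL_n(O_F)) = 1`.  A
predicate on the measure PARAMETER (ED.2: including «the σ-algebra is the Borel one», `BorelSpace`, so that the measurable structure
supplied by the consumer is the topological one); no instance is declared. [cite: Liu2021, §1.3 (p. 12)] -/
def IsNormalizedHaarGL [MeasurableSpace (GL (Fin n) F)] (dg : Measure (GL (Fin n) F)) : Prop :=
  BorelSpace (GL (Fin n) F) ∧ dg.IsHaarMeasure ∧ dg (S.glInt n) = 1

/-- **The orbital integral `Orb(s; f, φ; ζ, y) := ∫_{GL_n(F)} f(g⁻¹ζg) φ(g⁻¹y_1, y_2 g) μ_{E/F}(det g) |det g|_E^s dg`** (p. 12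
L30–33; l. 868–871), as a REAL Bochner integral against the measure parameter `dg` (READINGS F1, M1: `μ_{E/F}(det g) =
(−1)^{val det g}`, `|det g|_E^s` = `cpow` of the positive real `|det g|_E`). [cite: Liu2021, §1.3 (p. 12)] -/
def orbIntegral [MeasurableSpace (GL (Fin n) F)] (dg : Measure (GL (Fin n) F)) (s : ℂ)
    (f : Matrix (Fin n) (Fin n) E → ℂ) (φ : Mn F n → ℂ) (ζ : Matrix (Fin n) (Fin n) E) (y : Mn F n) : ℂ :=
  ∫ g, f (S.act n g (ζ, y)).1 * φ (S.act n g (ζ, y)).2 *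
      ((S.eta (algebraMap F E (g : Matrix (Fin n) (Fin n) F).det) : ℤ) : ℂ) *
      ((S.absE (algebraMap F E (g : Matrix (Fin n) (Fin n) F).det) : ℂ) ^ s) ∂dg

/-- **[Liu2021, §1.3, p. 12 L33–35] AS PRINTED** (l. 871–872): «It is clear that the product `ω(ζ, y) Orb(0; f, φ; ζ, y)` depends
only on the `GL_n(F)`-orbit of `(ζ, y)`» — for Schwartz `f`, `φ`, a regular semisimple `ζ ∈ S_n(F)`, `y`, and every `g ∈ GL_n(F)`,
the product at `(ζ, y)g` equals the product at `(ζ, y)` (READING U1), for the normalized Haar measure `dg`.  Named fact, NO PROOF.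
A consumer takes `(h : S.OrbitInvarianceAsPrinted n dg)`. [cite: Liu2021, §1.3 (p. 12)] -/
def OrbitInvarianceAsPrinted [MeasurableSpace (GL (Fin n) F)] (dg : Measure (GL (Fin n) F)) : Prop :=
  S.IsNormalizedHaarGL n dg →
    ∀ (f : Matrix (Fin n) (Fin n) E → ℂ) (φ : Mn F n → ℂ), IsSchwartz f → IsSchwartz φ →
      ∀ ζ ∈ S.symmSpace n, ∀ (y : Mn F n), S.IsRegularSemisimple n ζ y → ∀ g : GL (Fin n) F,
        ((S.transferFactor n (S.act n g (ζ, y)).1 (S.act n g (ζ, y)).2 : ℤ) : ℂ) *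
            S.orbIntegral n dg 0 f φ (S.act n g (ζ, y)).1 (S.act n g (ζ, y)).2 =
          ((S.transferFactor n ζ y : ℤ) : ℂ) * S.orbIntegral n dg 0 f φ ζ y

/-- **[Liu2021, §1.3, p. 12 L18–21] AS PRINTED** (l. 863): «The matching relation induces a bijection `[S_n(F) × M_n(F)]_rs ≃
[U(V_n^+)(F) × V_n^+(E)]_rs ∐ [U(V_n^-)(F) × V_n^-(E)]_rs`», for hermitian spaces `V⁺`, `V⁻` of even / odd determinant valuation
(READINGS H1, U1).  TYPED as the four clauses of «induces a bijection on orbits»: (i) matching is constant on orbits on both sides;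
(ii) every regular semisimple `(ζ, y)` (`ζ ∈ S_n(F)`) matches a regular semisimple pair in `V⁺` or in `V⁻`, (iii) never in both,
and two regular semisimple pairs of the same `V^δ` matching the same `(ζ, y)` lie in one `U(V^δ)(F)`-orbit; (iv) every regular
semisimple `(ξ, x)` of `V^δ` is matched by some regular semisimple `(ζ, y)`.  Named fact ([Liu14, §5.3]), NO PROOF.  A consumer
takes `(h : S.MatchingBijectionAsPrinted n Vp Vm)`. [cite: Liu2021, §1.3 (p. 12)] -/
def MatchingBijectionAsPrinted (Vp Vm : HermSpaceLoc S n) : Prop :=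
  Vp.parity = 1 → Vm.parity = -1 →
    (∀ (V : HermSpaceLoc S n), (V = Vp ∨ V = Vm) →
        ∀ ζ ∈ S.symmSpace n, ∀ (y : Mn F n) (ξ : V.U) (x : Fin n → E) (g : GL (Fin n) F) (u : V.U),
          Matches V ζ y ξ x ↔
            Matches V (S.act n g (ζ, y)).1 (S.act n g (ζ, y)).2 (actU V u (ξ, x)).1 (actU V u (ξ, x)).2) ∧
    (∀ ζ ∈ S.symmSpace n, ∀ (y : Mn F n), S.IsRegularSemisimple n ζ y →
        ∃ (V : HermSpaceLoc S n) (ξ : V.U) (x : Fin n → E),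
          (V = Vp ∨ V = Vm) ∧ IsRegularSemisimpleU V ξ x ∧ Matches V ζ y ξ x) ∧
    (∀ ζ ∈ S.symmSpace n, ∀ (y : Mn F n), S.IsRegularSemisimple n ζ y →
        (¬ ((∃ (ξ : Vp.U) (x : Fin n → E), IsRegularSemisimpleU Vp ξ x ∧ Matches Vp ζ y ξ x) ∧
            (∃ (ξ : Vm.U) (x : Fin n → E), IsRegularSemisimpleU Vm ξ x ∧ Matches Vm ζ y ξ x))) ∧
          ∀ (V : HermSpaceLoc S n), (V = Vp ∨ V = Vm) →
            ∀ (ξ ξ' : V.U) (x x' : Fin n → E), IsRegularSemisimpleU V ξ x → IsRegularSemisimpleU V ξ' x' →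
              Matches V ζ y ξ x → Matches V ζ y ξ' x' → ∃ u : V.U, actU V u (ξ, x) = (ξ', x')) ∧
    (∀ (V : HermSpaceLoc S n), (V = Vp ∨ V = Vm) →
        ∀ (ξ : V.U) (x : Fin n → E), IsRegularSemisimpleU V ξ x →
          ∃ ζ ∈ S.symmSpace n, ∃ y : Mn F n, S.IsRegularSemisimple n ζ y ∧ Matches V ζ y ξ x)

/-- **[Liu2021, §1.3, p. 12 L22–26] AS PRINTED** (l. 864–865): «Denote by `[S_n(F) × M_n(F)]^±_rs ⊆ [S_n(F) × M_n(F)]_rs` the subset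
corresponding to orbits in `[U(V_n^±)(F) × V_n^±(E)]_rs`. Then a regular semisimple orbit `(ζ, y)` belongs to `[S_n(F) × M_n(F)]^δ_rs`
for `δ = +` (resp. `δ = −`) if and only if the `det((y_2 ζ^{i+j−2} y_1)_{i,j=1}^n)` has even (resp. odd) valuation.»  TYPED
(READING S1, the definitional arrow reversed): for a hermitian space `V` of parity `δ`, a regular semisimple `(ζ, y)` matches some
regular semisimple pair of `V` iff `sign ζ y = δ`.  Named fact, NO PROOF.  A consumer takes `(h : S.SignCriterionAsPrinted n V)`.
[cite: Liu2021, §1.3 (p. 12)] -/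
def SignCriterionAsPrinted (V : HermSpaceLoc S n) : Prop :=
  ∀ ζ ∈ S.symmSpace n, ∀ (y : Mn F n), S.IsRegularSemisimple n ζ y →
    ((∃ (ξ : V.U) (x : Fin n → E), IsRegularSemisimpleU V ξ x ∧ Matches V ζ y ξ x) ↔ S.sign n ζ y = V.parity)

variable {S n} in
/-- **The dual `L^* := {x ∈ V | (x, y)_V ∈ O_E for all y ∈ L}`** of a subset `L ⊆ V = E^n` under the hermitian form («dual lattice»,
p. 14 L10, p. 15 L17; l. 919, 961). REAL (as a set). [cite: Liu2021, §1.3 (p. 14)] -/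
def dualSet (V : HermSpaceLoc S n) (L : Set (Fin n → E)) : Set (Fin n → E) :=
  {x | ∀ y ∈ L, V.form x y ∈ 𝒪[E]}

variable {S n} in
/-- **«a self-dual lattice `Λ` in `V`»** (Conj. 1.9 (2), p. 13 L6; l. 888): an `O_E`-submodule of `E^n`, finitely generated and
spanning `E^n` (a lattice), equal to its dual. REAL. [cite: Liu2021, Conj. 1.9 (p. 13)] -/
def IsSelfDualLattice (V : HermSpaceLoc S n) (Λ : Submodule 𝒪[E] (Fin n → E)) : Prop :=
  Λ.FG ∧ Submodule.span E (Λ : Set (Fin n → E)) = ⊤ ∧ (Λ : Set (Fin n → E)) = dualSet V Λ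

variable {S n} in
/-- **«`K_n` is the stabilizer of `Λ_n`»** in `U(V)(F)` (Conj. 1.9 (2), p. 13 L6–7; l. 888): `{g | gΛ = Λ}`. REAL (as a set).
[cite: Liu2021, Conj. 1.9 (p. 13)] -/
def stabilizer (V : HermSpaceLoc S n) (Λ : Submodule 𝒪[E] (Fin n → E)) : Set V.U :=
  {g | ∀ x ∈ Λ, (((g : GL (Fin n) E) : Matrix (Fin n) (Fin n) E) *ᵥ x) ∈ Λ ∧
    ((((g⁻¹ : V.U) : GL (Fin n) E) : Matrix (Fin n) (Fin n) E) *ᵥ x) ∈ Λ}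

variable {S n} in
/-- **The unitary orbital integral `∫_{U(V)} 𝟙_K(g⁻¹ξg) 𝟙_Λ(g⁻¹x) dg`** (right-hand side of (1.2), p. 13 L3–4; l. 883–885), as a
REAL Bochner integral of the product of indicators against the measure parameter `du`. [cite: Liu2021, Conj. 1.9 (p. 13)] -/
def orbIntegralU (V : HermSpaceLoc S n) [MeasurableSpace V.U] (du : Measure V.U) (K : Set V.U)
    (Λ : Submodule 𝒪[E] (Fin n → E)) (ξ : V.U) (x : Fin n → E) : ℂ :=
  ∫ g, K.indicator (fun _ => (1 : ℂ)) (actU V g (ξ, x)).1 *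
      (Λ : Set (Fin n → E)).indicator (fun _ => (1 : ℂ)) (actU V g (ξ, x)).2 ∂du

/-! ## Item 2: item 1.9 (pp. 12–13) — VOCABULARY PREDICATES — and Remark 1.10 (p. 13) -/

/-- **[Liu2021, item 1.9 (1)] — [statement] ONLY, typed as a VOCABULARY PREDICATE (see the module docstring's HONESTY NOTE; its
printed proved status is Remark 1.10 (1) = `Rem110_1AsPrinted`)** (p. 12 L38–44; l. 875–880): «For every regular semisimple orbit `(ζ, y) ∈ [S_n(F) × M_n(F)]_rs`, we have (1)
if `(ζ, y) ∈ [S_n(F) × M_n(F)]^-_rs`, then `ω(ζ, y) Orb(0; 𝟙_{S_n(O_F)}, 𝟙_{M_n(O_F)}; ζ, y) = 0`.»  TYPED (READINGS S1, F1, U1) for the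
normalized Haar measure parameter `dg`.  Nothing asserted. [cite: Liu2021, §1.3 item 1.9 (1) (p. 12)] -/
def Item19Part1 [MeasurableSpace (GL (Fin n) F)] (dg : Measure (GL (Fin n) F)) : Prop :=
  S.IsNormalizedHaarGL n dg →
    ∀ ζ ∈ S.symmSpace n, ∀ (y : Mn F n), S.IsRegularSemisimple n ζ y → S.sign n ζ y = -1 →
      ((S.transferFactor n ζ y : ℤ) : ℂ) *
          S.orbIntegral n dg 0 ((S.symmSpaceInt n).indicator fun _ => (1 : ℂ))
            ((S.MnInt n).indicator fun _ => (1 : ℂ)) ζ y = 0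

variable {S n} in
/-- **[Liu2021, item 1.9 (2)] — [statement] ONLY, typed as a VOCABULARY PREDICATE (HONESTY NOTE; known for `p` large, Remark
1.10 (2) = `Rem110_2AsPrinted`)** (p. 13 L1–8; l. 882–889): «(2) if `(ζ, y) ∈ [S_n(F) × M_n(F)]^+_rs`, then (1.2) `ω(ζ, y) Orb(0; 𝟙_{S_n(O_F)},
𝟙_{M_n(O_F)}; ζ, y) = ∫_{U(V_n^+)} 𝟙_{K_n}(g⁻¹ξg) 𝟙_{Λ_n}(g⁻¹x) dg` where `(ξ, x) ∈ [U(V_n^+)(F) × V_n^+(E)]_rs` is the unique orbit that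
matches `(ζ, y)`, `Λ_n` is a self-dual lattice in `V_n^+`, `K_n` is the stabilizer of `Λ_n`, and `dg` is the Haar measure on `U(V_n^+)`
under which `K_n` has volume `1`.»  TYPED (READINGS S1, H1, F1, U1) for `V = V_n^+` (`parity = 1`), a self-dual `Λ`, `K_n = stabilizer Λ`,
and the two normalized Haar measure parameters («`dg` … under which `K_n` has volume `1`»: `du` Haar on the Borel σ-algebra with `du(K_n) = 1`, ED.2).  Nothing asserted. [cite: Liu2021, §1.3 item 1.9 (2) (p. 13)] -/
def Item19Part2 [MeasurableSpace (GL (Fin n) F)] (dg : Measure (GL (Fin n) F)) (V : HermSpaceLoc S n)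
    (Λ : Submodule 𝒪[E] (Fin n → E)) [MeasurableSpace V.U] (du : Measure V.U) : Prop :=
  S.IsNormalizedHaarGL n dg → V.parity = 1 → IsSelfDualLattice V Λ →
    BorelSpace V.U ∧ du.IsHaarMeasure ∧ du (stabilizer V Λ) = 1 →
    ∀ ζ ∈ S.symmSpace n, ∀ (y : Mn F n), S.IsRegularSemisimple n ζ y → S.sign n ζ y = 1 →
      ∀ (ξ : V.U) (x : Fin n → E), IsRegularSemisimpleU V ξ x → Matches V ζ y ξ x →
        ((S.transferFactor n ζ y : ℤ) : ℂ) *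
            S.orbIntegral n dg 0 ((S.symmSpaceInt n).indicator fun _ => (1 : ℂ))
              ((S.MnInt n).indicator fun _ => (1 : ℂ)) ζ y =
          orbIntegralU V du (stabilizer V Λ) Λ ξ x

/-- **[Liu2021, Remark 1.10, first sentence] AS PRINTED** (p. 13 L20; l. 893): «[item] 1.9(1) is known by [Liu14, Proposition
5.14].» (editorial bracket: the printed word is the item's heading, see HONESTY NOTE).  TYPED: `Item19Part1` holds for every normalized Haar measure parameter (the content of the sentence; its provenance is
[Liu2014RelativeTraceFormulae, Prop. 5.14]).  Named fact, NO PROOF here.  A consumer takes `(h : S.Rem110_1AsPrinted n)`.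
[cite: Liu2021, Rem. 1.10 (p. 13)] [cite: Liu2014RelativeTraceFormulae, Prop. 5.14] -/
def Rem110_1AsPrinted : Prop :=
  ∀ [MeasurableSpace (GL (Fin n) F)] (dg : Measure (GL (Fin n) F)), S.Item19Part1 n dg

end AFLSetup

/-- **[Liu2021, Remark 1.10, second sentence] AS PRINTED** (p. 13 L20–21; l. 893–894): «[item] 1.9(2) is known for `p`
sufficiently large by [Liu14, Theorem 5.15].» (editorial bracket, HONESTY NOTE).  TYPED (READING P1) for the rank `n`: there is a bound `N` such that `Item19Part2`
holds for every §1.3 set-up of residue characteristic `≥ N` and all admissible parameters.  Named fact, NO PROOF here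
([Liu2014RelativeTraceFormulae, Thm. 5.15]).  A consumer takes `(h : Rem110_2AsPrinted n)`.
[cite: Liu2021, Rem. 1.10 (p. 13)] [cite: Liu2014RelativeTraceFormulae, Thm. 5.15] -/
def Rem110_2AsPrinted (n : ℕ) : Prop :=
  ∃ N : ℕ,
    ∀ (F E : Type) [Field F] [ValuativeRel F] [TopologicalSpace F] [IsNonarchimedeanLocalField F] [Field E]
      [ValuativeRel E] [TopologicalSpace E] [IsNonarchimedeanLocalField E] [Algebra F E] [ValuativeExtension F E]
      (S : AFLSetup F E), N ≤ ringChar 𝓀[F] →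
        ∀ [MeasurableSpace (GL (Fin n) F)] (dg : Measure (GL (Fin n) F)) (V : AFLSetup.HermSpaceLoc S n)
          (Λ : Submodule 𝒪[E] (Fin n → E)) [MeasurableSpace V.U] (du : Measure V.U),
          AFLSetup.Item19Part2 dg V Λ du

end Literature.NumberTheory.Automorphic.Liu2021.Sec13RelativeFundamentalLemma

end
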